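import Summits.QuantumFields.YangMills.Theses.BalabanMarkovExport

/-!
# Assembly of route `BalabanMarkovExport` (planner seat ym-idea-9 g3; route status draft at the time of writing)

The route file's kernel-checked deciding theorem `closes` packaged as the proof of the route's `Assembly` item (stmt-QuantumFields-27294):
the recorded implication from the route's items to the spine crux `BalabanLadder.UVSeamRec`.  No summit, no rung and no crux is proved here; every crux of the route
stays open.  Width seat ym-line-sfw-p2-w2 g20 (cell `ym-idea-1`, free hands).
-/

namespace Summit.QuantumFields.YangMills.Theorems

open Summit.QuantumFields.YangMills.Theses.BalabanMarkovExport in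
/-- The `Assembly` item of route `BalabanMarkovExport` holds: it is the route's deciding theorem `closes` read as an implication. [folklore] -/
theorem balabanMarkovExport_assembly : Summit.QuantumFields.YangMills.Theses.BalabanMarkovExport.Assembly :=
  fun h₁ h₂ h₃ h₄ h₅ h₆ => closes h₁ h₂ h₃ h₄ h₅ h₆

end Summit.QuantumFields.YangMills.Theorems
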